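import Summits.CriticalPhenomena.Ising3DConformalLimit.Theses.EnergyNotSigmaSquared
import Summits.CriticalPhenomena.Ising3DConformalLimit.Theorems.GapForcesFarMerging.Negative.IsingCertificate
import Summits.CriticalPhenomena.Ising3DConformalLimit.Theorems.MoebiusLimitExists.Negative.FreePermutations
import Literature.Probability.LatticeModels.SourcedDoubleCurrentsSwitching
import Literature.Probability.LatticeModels.CurrentsAvoidMixing
import Literature.Probability.LatticeModels.DirInvCorrLength
import Literature.Probability.LatticeModels.CriticalTwoPointLower
import Literature.Probability.LatticeModels.MeanFieldDifferentialInequality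
import Literature.Probability.LatticeModels.IsingMonotonicity

/-!
# Strict positivity of the single-pinch truncation
(line `rp-unpinch-single-passage` of crux `GapForcesFarMerging`, item stmt-CriticalPhenomena-4468;
stub `stub_singlePinchPositive`)

For `m ≥ 1`, `b = e₂`, `u = (2m, m, 0)`, `w = (2m, -m, 0)` the truncated critical correlation
`⟨σ₀σ_bσ_uσ_w⟩_{β_c} - ⟨σ₀σ_b⟩_{β_c}⟨σ_uσ_w⟩_{β_c}` of the nearest-neighbour Ising model on `ℤ³` is
strictly positive. In the box `Λ_L` (free boundary condition) the switching lemma (ADC21 (3.7),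
`isingCorr_free_box_mul_twoPoint_eq`) writes the truncation as `⟨σ_Q⟩_L · P^{Q,∅}_L[u ↮ w]`; the
event "no bond of the edge boundary `D` of a finite `S ∋ b, u`, `S ∌ 0, w` is open" forces
`u ↮ w`, its probability factorises (`sourcedDoubleCurrentLaw_real_localCylinder_eq`,
`sourcedTrace_eq_sum`, `sourcedAvoid_eq_div`) and the change of graph as a tilt
(`isingExpect_free_mul_of_le`) bounds it below by `⟨σ_Q⟩_{Λ_L; ℤ³∖D} e^{-2β|D|}/⟨σ_Q⟩_L`,
uniformly in `L` (Griffiths' monotonicity in the volume) and positively (GKS II along two lattice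
paths, `isingCorr_pair_pos_of_adj`). The box limit is `criticalCorr_wellDefined_holds`.
-/

noncomputable section

namespace Summit.CriticalPhenomena.Ising3DConformalLimit.EnergyNotSigmaSquaredGapForcesFarMerging

open MeasureTheory Filter Topology
open scoped symmDiff
open Literature.Probability.LatticeModels
open Literature.Probability.Percolation (BondConfig openConn openGraph openGraph_adj localCylinder
  box_induce_reachable measurableSet_openConn_holds)
open Summit.CriticalPhenomena.Ising3DConformalLimit.Theses.EnergyNotSigmaSquared
open Summit.CriticalPhenomena.Ising3DConformalLimit.Theorems.GapForcesFarMerging.Negative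
  (e₁ e₂ cc2 FarMergingShape)

/-! ### Elementary helpers -/

/-- A bond with both endpoints in `S` is not in the edge boundary of `S`. [folklore] -/
theorem mk_notMem_edgeBoundary_of_mem {V : Type*} [DecidableEq V] {G : SimpleGraph V}
    [G.LocallyFinite] {S : Finset V} {p q : V} (hp : p ∈ S) (hq : q ∈ S) :
    s(p, q) ∉ edgeBoundary G S := by
  intro h
  obtain ⟨-, -, y, hy, hye⟩ := mem_edgeBoundary_iff.1 h
  rcases Sym2.mem_iff.1 hye with rfl | rfl
  · exact hy hp
  · exact hy hq

/-- A bond with no endpoint in `S` is not in the edge boundary of `S`. [folklore] -/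
theorem mk_notMem_edgeBoundary_of_notMem {V : Type*} [DecidableEq V] {G : SimpleGraph V}
    [G.LocallyFinite] {S : Finset V} {p q : V} (hp : p ∉ S) (hq : q ∉ S) :
    s(p, q) ∉ edgeBoundary G S := by
  intro h
  obtain ⟨-, ⟨x, hx, hxe⟩, -⟩ := mem_edgeBoundary_iff.1 h
  rcases Sym2.mem_iff.1 hxe with rfl | rfl
  · exact hp hx
  · exact hq hx

/-- `Λ_m + Λ_k ⊆ Λ_n` for `m + k ≤ n`. [folklore] -/
theorem add_mem_box {d m k n : ℕ} {x v : Site d} (hx : x ∈ box d m) (hv : v ∈ box d k)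
    (hn : m + k ≤ n) : x + v ∈ box d n := by
  rw [mem_box] at hx hv ⊢
  intro i
  obtain ⟨⟨h1, h2⟩, h3, h4⟩ := And.intro (hx i) (hv i)
  simp only [Pi.add_apply]
  constructor <;> omega

/-- A symmetric difference of subsets of `Λ` lies in `Λ`. [folklore] -/
theorem symmDiff_subset_of_subset {V : Type*} [DecidableEq V] {A B Λ : Finset V} (hA : A ⊆ Λ)
    (hB : B ⊆ Λ) : A ∆ B ⊆ Λ :=
  (symmDiff_le_sup (a := A) (b := B)).trans (Finset.union_subset hA hB)

/-! ### GKS II along a walk -/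

/-- **GKS II along a walk.** For a locally finite graph `G`, `β > 0`, the free boundary condition
in `Λ`, and a map `φ` from the vertices of a graph `K` into `Λ` sending edges to edges of `G`:
if `⟨σ_{A ∆ {φ x}}⟩ > 0` and `x`, `y` are joined by a walk of `K`, then `⟨σ_{A ∆ {φ y}}⟩ > 0`
(each step: `⟨σ_{A∆{p}}⟩⟨σ_pσ_q⟩ ≤ ⟨σ_{A∆{q}}⟩` by GKS II, and `⟨σ_pσ_q⟩ > 0` for a bond,
`isingCorr_pair_pos_of_adj`). [folklore] -/
theorem isingCorr_symmDiff_pos_of_walk {V W : Type*} [DecidableEq V] (G : SimpleGraph V)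
    [G.LocallyFinite] {K : SimpleGraph W} (φ : W → V) {Λ A : Finset V} {β : ℝ} (hβ : 0 < β)
    (hA : A ⊆ Λ) (hφΛ : ∀ w, φ w ∈ Λ) (hφ : ∀ w w', K.Adj w w' → G.Adj (φ w) (φ w'))
    {x y : W} (p : K.Walk x y) {a₀ a₁ : V} (hx : φ x = a₀) (hy : φ y = a₁)
    (h0 : 0 < isingCorr G Λ β 0 .free (A ∆ {a₀})) :
    0 < isingCorr G Λ β 0 .free (A ∆ {a₁}) := by
  subst hx hy
  induction p with
  | nil => exact h0
  | @cons a b c hab p ih =>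
    refine ih ?_
    have hadj := hφ a b hab
    have hpair : 0 < isingCorr G Λ β 0 .free ({φ a} ∆ {φ b}) := by
      rw [Current.symmDiff_singleton_eq_pair hadj.ne]
      exact isingCorr_pair_pos_of_adj G hadj (hφΛ a) (hφΛ b) hβ le_rfl (Or.inl rfl)
    have h1 : A ∆ {φ a} ⊆ Λ := symmDiff_subset_of_subset hA (Finset.singleton_subset_iff.2 (hφΛ a))
    have h2 : {φ a} ∆ {φ b} ⊆ Λ := symmDiff_subset_of_subset
      (Finset.singleton_subset_iff.2 (hφΛ a)) (Finset.singleton_subset_iff.2 (hφΛ b))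
    have hgks : isingCorr G Λ β 0 .free (A ∆ {φ a}) * isingCorr G Λ β 0 .free ({φ a} ∆ {φ b}) ≤
        isingCorr G Λ β 0 .free ((A ∆ {φ a}) ∆ ({φ a} ∆ {φ b})) :=
      GriffithsKellySherman.gks_two_holds G hβ.le le_rfl (Or.inl rfl) h1 h2
    rw [symmDiff_assoc, symmDiff_symmDiff_cancel_left] at hgks
    exact (mul_pos h0 hpair).trans_le hgks

/-! ### The finite-volume lower bound (any dimension) -/

/-- **Finite-volume single-pinch lower bound.** For `β > 0`, `A ⊆ Λ_L` of even cardinality,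
`u, v ∈ Λ_L`, a finite set `S ∋ u`, `S ∌ v` whose edge boundary `D` lies inside `Λ_L`, and
`Q = A ∆ {u} ∆ {v}`:
`⟨σ_Q⟩^∅_{Λ_L; ℤ^d ∖ D} · e^{-2β|D|} ≤ ⟨σ_Q⟩^∅_{Λ_L} - ⟨σ_A⟩^∅_{Λ_L}⟨σ_uσ_v⟩^∅_{Λ_L}`.
Switching lemma in the box (ADC21 (3.7): the right side is `⟨σ_Q⟩_L · P^{Q,∅}_{Λ_L}[u ↮ v]`),
the inclusion `{no bond of D open} ⊆ {u ↮ v}`, the factorisation of the sourced double current on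
cylinders with the avoidance identity `P^A_{Λ_L}[n ≡ 0 on D] = ⟨σ_A e^{-βK_D}⟩/⟨σ_A⟩`
(ADS15 (2.13)–(2.14)), the change of graph as a tilt and `e^{-βK_D} ≥ e^{-β|D|}`.
[cite: AizenmanDuminilCopinAnnals2021, eq. (3.7) with Lemma 3.3] -/
theorem truncatedPair_lower_bound (d L : ℕ) {β : ℝ} (hβ : 0 < β) {A : Finset (Site d)}
    (hA : A ⊆ box d L) (hAev : Even A.card) {u v : Site d} (hu : u ∈ box d L) (hv : v ∈ box d L)
    {S : Finset (Site d)} (huS : u ∈ S) (hvS : v ∉ S)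
    (hD : edgeBoundary (zdGraph d) S ⊆ edgesIn (zdGraph d) (box d L)) :
    isingCorr ((zdGraph d).deleteEdges (↑(edgeBoundary (zdGraph d) S) : Set (Sym2 (Site d))))
          (box d L) β 0 .free (A ∆ ({u} ∆ {v})) *
        Real.exp (-(β * (edgeBoundary (zdGraph d) S).card)) ^ 2 ≤
      isingCorr (zdGraph d) (box d L) β 0 .free (A ∆ ({u} ∆ {v})) -
        isingCorr (zdGraph d) (box d L) β 0 .free A *
          isingTwoPoint (zdGraph d) (box d L) β 0 .free u v := by
  classical
  set D := edgeBoundary (zdGraph d) S with hDdef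
  set Q := A ∆ ({u} ∆ {v}) with hQdef
  set P := sourcedDoubleCurrentLaw d L β Q ∅ with hPdef
  set G₁ : SimpleGraph (Site d) := (zdGraph d).deleteEdges (↑D : Set (Sym2 (Site d))) with hG₁
  -- `Q ⊆ Λ_L`, `#Q` even, the normalisers do not vanish, `⟨σ_Q⟩_L > 0`
  have hQΛ : Q ⊆ box d L := symmDiff_subset_of_subset hA (symmDiff_subset_of_subset
    (Finset.singleton_subset_iff.2 hu) (Finset.singleton_subset_iff.2 hv))
  have hQev : Even Q.card := by
    rw [hQdef, even_card_symmDiff_iff, even_card_symmDiff_iff, Finset.card_singleton, Finset.card_singleton]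
    exact iff_of_true hAev Iff.rfl
  have hZQ : currentSum (freeBoxGraph d L) β (boxSources d L Q) ≠ 0 :=
    (currentSum_boxSources_pos d hβ hQΛ hQev).ne'
  have hZ0 : currentSum (freeBoxGraph d L) β (boxSources d L ∅) ≠ 0 :=
    (currentSum_boxSources_pos d hβ (Finset.empty_subset _) (by simp)).ne'
  haveI : IsProbabilityMeasure P := isProbabilityMeasure_sourcedDoubleCurrentLaw hβ.le hZQ hZ0
  have hQpos : 0 < isingCorr (zdGraph d) (box d L) β 0 .free Q := isingCorr_free_box_pos d hβ hQΛ hQev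
  -- (1) switching: the truncation is `⟨σ_Q⟩ · P[u ↮ v]`
  have hsw : isingCorr (zdGraph d) (box d L) β 0 .free Q - isingCorr (zdGraph d) (box d L) β 0 .free A *
        isingTwoPoint (zdGraph d) (box d L) β 0 .free u v =
      isingCorr (zdGraph d) (box d L) β 0 .free Q * P.real (openConn u v)ᶜ := by
    rw [isingCorr_free_box_mul_twoPoint_eq d L hβ.le hA hu hv,
      probReal_compl_eq_one_sub (measurableSet_openConn_holds u v)]
    ring
  -- (2) inclusion: no bond of `D` open ⟹ `u ↮ v` (a `u → v` walk has a dart leaving `S`)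
  have hincl : P.real (localCylinder (↑D : Set (Sym2 (Site d))) ↑(∅ : Finset (Sym2 (Site d)))) ≤
      P.real (openConn u v)ᶜ := by
    have hmC := measurableSet_localCylinder_coe d D (↑(∅ : Finset (Sym2 (Site d))))
    have hmO : MeasurableSet (openConn u v : Set (BondConfig (Site d)))ᶜ := (measurableSet_openConn_holds u v).compl
    rw [sourcedDoubleCurrentLaw_real_congr_lattice d L β Q ∅ hmC (hmC.inter hmO) ?_]
    · exact measureReal_mono Set.inter_subset_right
    intro ω hω
    refine ⟨fun h => ⟨h, fun hconn => ?_⟩, fun h => h.1⟩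
    obtain ⟨p⟩ : (openGraph ω).Reachable u v := hconn
    obtain ⟨e, -, h1, h2⟩ := p.exists_boundary_dart (↑S : Set (Site d)) huS hvS
    have hadj := (openGraph_adj ω _ _).1 e.adj
    have heD : s(e.toProd.1, e.toProd.2) ∈ D := mem_edgeBoundary_iff.2
      ⟨hω hadj.1, ⟨_, h1, Sym2.mem_mk_left _ _⟩, ⟨_, h2, Sym2.mem_mk_right _ _⟩⟩
    exact Finset.notMem_empty _ (((mem_localCylinder_coe_iff D ∅ ω).1 h _ heD).2 hadj.1)
  -- (3) factorisation on the cylinder and the avoidance identity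
  have hfac : P.real (localCylinder (↑D : Set (Sym2 (Site d))) ↑(∅ : Finset (Sym2 (Site d)))) =
      isingExpect (zdGraph d) (box d L) β 0 .free (fun σ => spinProduct Q σ * expNegBonds d β D σ) /
          isingCorr (zdGraph d) (box d L) β 0 .free Q *
        isingExpect (zdGraph d) (box d L) β 0 .free (expNegBonds d β D) := by
    have h1 := sourcedDoubleCurrentLaw_real_localCylinder_eq d L hβ.le hZQ hZ0 (Finset.empty_subset D)
    have h2 := sourcedTrace_eq_sum d L β Q (Finset.empty_subset D)
    have h3 := sourcedTrace_eq_sum d L β ∅ (Finset.empty_subset D)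
    simp only [Finset.powerset_empty, Finset.sum_singleton, Finset.union_empty, if_true,
      Finset.card_empty, pow_zero, one_mul, Finset.sdiff_empty] at h1 h2 h3
    rw [h2, h3, sourcedAvoid_eq_div d L β hD hQΛ, sourcedAvoid_eq_div d L β hD (Finset.empty_subset _),
      isingCorr_empty, div_one] at h1
    rw [h1]
    congr 2; funext σ; simp [spinProduct]
  -- (4) change of graph as a tilt: `⟨σ_Q e^{-βK_D}⟩ = ⟨σ_Q⟩_{ℤ^d ∖ D} ⟨e^{-βK_D}⟩`
  have hle : G₁ ≤ zdGraph d := SimpleGraph.deleteEdges_le _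
  have hdiff : edgesIn (zdGraph d) (box d L) \ edgesIn G₁ (box d L) = D := by
    show _ \ edgesIn ((zdGraph d).deleteEdges (↑D : Set (Sym2 (Site d)))) (box d L) = D
    rw [edgesIn_deleteEdges, Finset.sdiff_sdiff_self_left, Finset.inter_eq_right.2 hD]
  have hmeas : Measurable fun σ : SpinConfig (Site d) => spinProduct Q σ * expNegBonds d β D σ :=
    (measurable_spinProduct _).mul (measurable_expNegBonds d β D)
  have hk1 := isingExpect_free_mul_of_le hle (box d L) β 0 hmeas
  have hk2 := isingExpect_free_mul_of_le hle (box d L) β 0 (measurable_expNegBonds d β D)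
  rw [hdiff] at hk1 hk2
  have hf1 : (fun σ : SpinConfig (Site d) => spinProduct Q σ * expNegBonds d β D σ *
      ∏ e ∈ D, Real.exp (β * bondSpin σ e)) = spinProduct Q := by
    funext σ; rw [mul_assoc, expNegBonds_mul_prod_exp, mul_one]
  have hf2 : (fun σ : SpinConfig (Site d) => expNegBonds d β D σ *
      ∏ e ∈ D, Real.exp (β * bondSpin σ e)) = fun _ => (1 : ℝ) :=
    funext (expNegBonds_mul_prod_exp d β D)
  rw [hf1] at hk1; rw [hf2, isingExpect_const] at hk2
  set Ef := isingExpect (zdGraph d) (box d L) β 0 .free (fun σ => spinProduct Q σ * expNegBonds d β D σ)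
  set Ee := isingExpect (zdGraph d) (box d L) β 0 .free (expNegBonds d β D)
  set EW := isingExpect G₁ (box d L) β 0 .free (fun σ => ∏ e ∈ D, Real.exp (β * bondSpin σ e))
  change Ef * EW = isingCorr G₁ (box d L) β 0 .free Q at hk1
  have htilt : Ef = isingCorr G₁ (box d L) β 0 .free Q * Ee := by
    calc Ef = Ef * (Ee * EW) := by rw [hk2, mul_one]
      _ = Ef * EW * Ee := by ring
      _ = _ := by rw [hk1]
  -- (5) `⟨e^{-βK_D}⟩ ≥ e^{-β|D|}`
  have hexp : Real.exp (-(β * D.card)) ≤ Ee := by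
    rw [← isingExpect_const (zdGraph d) (box d L) β 0 .free (Real.exp (-(β * D.card)))]
    refine isingExpect_mono_fun (zdGraph d) (box d L) β 0 .free measurable_const
      (measurable_expNegBonds d β D) fun σ => Real.exp_le_exp.2 ?_
    have hsum : ∑ e ∈ D, bondSpin σ e ≤ D.card := by
      calc ∑ e ∈ D, bondSpin σ e ≤ ∑ _e ∈ D, (1 : ℝ) := Finset.sum_le_sum fun e _ => by
              rcases bondSpin_eq_one_or σ e with h | h <;> rw [h]
              norm_num
        _ = D.card := by simp
    nlinarith
  -- (6) assembly
  have hQ1 : 0 ≤ isingCorr G₁ (box d L) β 0 .free Q := GriffithsKellySherman.gks_one_holds _ hβ.le le_rfl (Or.inl rfl) hQΛ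
  calc isingCorr G₁ (box d L) β 0 .free Q * Real.exp (-(β * D.card)) ^ 2
      ≤ isingCorr G₁ (box d L) β 0 .free Q * Ee ^ 2 :=
        mul_le_mul_of_nonneg_left (pow_le_pow_left₀ (Real.exp_pos _).le hexp 2) hQ1
    _ = isingCorr (zdGraph d) (box d L) β 0 .free Q *
          P.real (localCylinder (↑D : Set (Sym2 (Site d))) ↑(∅ : Finset (Sym2 (Site d)))) := by
        rw [hfac, htilt]; field_simp
    _ ≤ isingCorr (zdGraph d) (box d L) β 0 .free Q * P.real (openConn u v)ᶜ :=
        mul_le_mul_of_nonneg_left hincl hQpos.le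
    _ = _ := hsw.symm

/-! ### The geometry on `ℤ³`: a bound uniform in the box -/

/-- **Uniform finite-volume bound for the single pinch.** For `β > 0` and `m ≥ 1` there are
`c > 0` and `L₀` with `c ≤ ⟨σ₀σ_{e₂}σ_uσ_w⟩^∅_{Λ_L} - ⟨σ₀σ_{e₂}⟩^∅_{Λ_L}⟨σ_uσ_w⟩^∅_{Λ_L}` for all
`L ≥ L₀`, where `u = (2m,m,0)`, `w = (2m,-m,0)`: `truncatedPair_lower_bound` with
`S = Λ_m + (m, m+1, 0) ∋ e₂, u` (and `0, w ∉ S`); `⟨σ_Q⟩_{Λ_L; ℤ³∖D}` is bounded below by its value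
in `Λ_{2m+2}` (Griffiths), positive by GKS II along a path from `e₂` to `u` inside `S` and a path
from `0` to `w` inside `Λ_m + (m, -m, 0)` (below `S`). [folklore] -/
theorem singlePinch_box_lower_bound {β : ℝ} (hβ : 0 < β) {m : ℕ} (hm : 1 ≤ m) :
    ∃ c : ℝ, 0 < c ∧ ∃ L₀ : ℕ, ∀ L : ℕ, L₀ ≤ L →
      c ≤ isingExpect (zdGraph 3) (box 3 L) β 0 .free
            (spinMonomial ![0, e₂, Pi.single 0 (2 * (m : ℤ)) + Pi.single 1 (m : ℤ),
              Pi.single 0 (2 * (m : ℤ)) - Pi.single 1 (m : ℤ)]) -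
          isingExpect (zdGraph 3) (box 3 L) β 0 .free (spinMonomial ![0, e₂]) *
            isingExpect (zdGraph 3) (box 3 L) β 0 .free
              (spinMonomial ![Pi.single 0 (2 * (m : ℤ)) + Pi.single 1 (m : ℤ),
                Pi.single 0 (2 * (m : ℤ)) - Pi.single 1 (m : ℤ)]) := by
  classical
  set b : Site 3 := e₂ with hb
  set u : Site 3 := Pi.single 0 (2 * (m : ℤ)) + Pi.single 1 (m : ℤ) with hu
  set w : Site 3 := Pi.single 0 (2 * (m : ℤ)) - Pi.single 1 (m : ℤ) with hw
  -- translation vectors: `S = Λ_m + t ∋ b, u`, and `Λ_m + t' ∋ 0, w` lies below `S`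
  set t : Site 3 := Pi.single 0 (m : ℤ) + Pi.single 1 ((m : ℤ) + 1) with ht
  set t' : Site 3 := Pi.single 0 (m : ℤ) - Pi.single 1 (m : ℤ) with ht'
  have htbox : t ∈ box 3 (m + 1) := by
    rw [mem_box]; intro i; fin_cases i <;> simp [ht] <;> omega
  have ht'box : t' ∈ box 3 m := by
    rw [mem_box]; intro i; fin_cases i <;> simp [ht']
  have hbt : b - t ∈ box 3 m := by
    rw [mem_box]; intro i; fin_cases i <;> simp [hb, ht]
  have hut : u - t ∈ box 3 m := by
    rw [mem_box]; intro i; fin_cases i <;> simp [hu, ht] <;> omega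
  have h0t' : (0 : Site 3) - t' ∈ box 3 m := by
    rw [mem_box]; intro i; fin_cases i <;> simp [ht']
  have hwt' : w - t' ∈ box 3 m := by
    rw [mem_box]; intro i; fin_cases i <;> simp [hw, ht']
    omega
  have ht1 : t 1 = (m : ℤ) + 1 := by simp [ht]
  have ht'1 : t' 1 = -(m : ℤ) := by simp [ht']
  have hw1 : w 1 = -(m : ℤ) := by simp [hw]
  set S : Finset (Site 3) := (box 3 m).image (· + t) with hS
  set D := edgeBoundary (zdGraph 3) S with hDdef
  -- membership in `S`
  have hmemS : ∀ y ∈ box 3 m, y + t ∈ S := fun y hy => Finset.mem_image_of_mem _ hy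
  have hnotS : ∀ x : Site 3, x 1 ≤ 0 → x ∉ S := by
    intro x hx hxS
    obtain ⟨y, hy, rfl⟩ := Finset.mem_image.1 hxS
    have := ((mem_box.1 hy) 1).1
    simp only [Pi.add_apply, ht1] at hx
    omega
  have huS : u ∈ S := by simpa using hmemS (u - t) hut
  have hwS : w ∉ S := hnotS w (by rw [hw1]; omega)
  -- everything inside `Λ_{2m+1}`; `D ⊆ ℰ(Λ_L)` for `L ≥ 2m+2`
  have hSbox : ∀ y ∈ box 3 m, y + t ∈ box 3 (2 * m + 1) := fun y hy => add_mem_box hy htbox (by omega)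
  have hS'box : ∀ y ∈ box 3 m, y + t' ∈ box 3 (2 * m + 1) := fun y hy => add_mem_box hy ht'box (by omega)
  have hubox : u ∈ box 3 (2 * m + 1) := by simpa using hSbox (u - t) hut
  have hbbox : b ∈ box 3 (2 * m + 1) := by simpa using hSbox (b - t) hbt
  have hwbox : w ∈ box 3 (2 * m + 1) := by simpa using hS'box (w - t') hwt'
  have h0box : (0 : Site 3) ∈ box 3 (2 * m + 1) := zero_mem_box 3 _
  have hDin : ∀ L, 2 * m + 2 ≤ L → D ⊆ edgesIn (zdGraph 3) (box 3 L) := by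
    intro L hL e he
    obtain ⟨heG, ⟨x, hxS, hxe⟩, -⟩ := mem_edgeBoundary_iff.1 he
    obtain ⟨y, hy, rfl⟩ := Finset.mem_image.1 hxS
    rw [mem_edgesIn_iff]
    refine ⟨heG, fun z hz => ?_⟩
    rcases eq_or_ne z (y + t) with rfl | hne
    · exact box_mono 3 (by omega) (hSbox y hy)
    · rw [(Sym2.mem_and_mem_iff hne.symm).1 ⟨hxe, hz⟩] at heG
      exact box_mono 3 (by omega) (mem_box_succ_of_zdGraph_adj 3 (hSbox y hy) heG)
  -- the `L`-independent constant `⟨σ_Q⟩_{Λ_{2m+2}; ℤ³ ∖ D} > 0`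
  set Q : Finset (Site 3) := {(0 : Site 3)} ∆ ({b} ∆ ({u} ∆ {w})) with hQdef
  set G₁ : SimpleGraph (Site 3) := (zdGraph 3).deleteEdges (↑D : Set (Sym2 (Site 3))) with hG₁
  have hsub : ∀ x ∈ box 3 (2 * m + 1), ({x} : Finset (Site 3)) ⊆ box 3 (2 * m + 2) :=
    fun x hx => Finset.singleton_subset_iff.2 (box_mono 3 (by omega) hx)
  have hQbox : Q ⊆ box 3 (2 * m + 2) := symmDiff_subset_of_subset (hsub 0 h0box)
    (symmDiff_subset_of_subset (hsub b hbbox) (symmDiff_subset_of_subset (hsub u hubox) (hsub w hwbox)))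
  have hA3 : ({b} ∆ {u} ∆ {(0 : Site 3)} : Finset (Site 3)) ⊆ box 3 (2 * m + 2) :=
    symmDiff_subset_of_subset (symmDiff_subset_of_subset (hsub b hbbox) (hsub u hubox)) (hsub 0 h0box)
  have hc₀ : 0 < isingCorr G₁ (box 3 (2 * m + 2)) β 0 .free Q := by
    -- move `b` to `u` inside `S`
    have hφΛ : ∀ y : ↥(↑(box 3 m) : Set (Site 3)), (y : Site 3) + t ∈ box 3 (2 * m + 2) :=
      fun y => box_mono 3 (by omega) (hSbox y y.2)
    have hφ : ∀ y y' : ↥(↑(box 3 m) : Set (Site 3)),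
        ((zdGraph 3).induce (↑(box 3 m) : Set (Site 3))).Adj y y' →
          G₁.Adj ((y : Site 3) + t) ((y' : Site 3) + t) := by
      intro y y' hyy'
      simp only [SimpleGraph.comap_adj, Function.Embedding.coe_subtype] at hyy'
      rw [hG₁, SimpleGraph.deleteEdges_adj]
      exact ⟨(zdGraph_adj_shift_iff t (y : Site 3) (y' : Site 3)).2 hyy',
        mk_notMem_edgeBoundary_of_mem (hmemS _ y.2) (hmemS _ y'.2)⟩
    obtain ⟨p⟩ := box_induce_reachable m hbt hut
    have h1 : 0 < isingCorr G₁ (box 3 (2 * m + 2)) β 0 .free ({b} ∆ {u}) :=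
      isingCorr_symmDiff_pos_of_walk G₁ (fun y : ↥(↑(box 3 m) : Set (Site 3)) => (y : Site 3) + t)
        hβ (A := {b}) (hsub b hbbox) hφΛ hφ p (sub_add_cancel b t) (sub_add_cancel u t)
        (by rw [symmDiff_self, Finset.bot_eq_empty, isingCorr_empty]; exact one_pos)
    -- move `0` to `w` below `S`
    have hψΛ : ∀ y : ↥(↑(box 3 m) : Set (Site 3)), (y : Site 3) + t' ∈ box 3 (2 * m + 2) :=
      fun y => box_mono 3 (by omega) (hS'box y y.2)
    have hlow : ∀ y : ↥(↑(box 3 m) : Set (Site 3)), (y : Site 3) + t' ∉ S := fun y => by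
      refine hnotS _ ?_
      have := ((mem_box.1 y.2) 1).2
      simp only [Pi.add_apply, ht'1]
      omega
    have hψ : ∀ y y' : ↥(↑(box 3 m) : Set (Site 3)),
        ((zdGraph 3).induce (↑(box 3 m) : Set (Site 3))).Adj y y' →
          G₁.Adj ((y : Site 3) + t') ((y' : Site 3) + t') := by
      intro y y' hyy'
      simp only [SimpleGraph.comap_adj, Function.Embedding.coe_subtype] at hyy'
      rw [hG₁, SimpleGraph.deleteEdges_adj]
      exact ⟨(zdGraph_adj_shift_iff t' (y : Site 3) (y' : Site 3)).2 hyy',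
        mk_notMem_edgeBoundary_of_notMem (hlow y) (hlow y')⟩
    obtain ⟨q⟩ := box_induce_reachable m h0t' hwt'
    have h2 : 0 < isingCorr G₁ (box 3 (2 * m + 2)) β 0 .free (({b} ∆ {u} ∆ {(0 : Site 3)}) ∆ {w}) :=
      isingCorr_symmDiff_pos_of_walk G₁ (fun y : ↥(↑(box 3 m) : Set (Site 3)) => (y : Site 3) + t')
        hβ hA3 hψΛ hψ q (sub_add_cancel 0 t') (sub_add_cancel w t')
        (by rwa [symmDiff_symmDiff_cancel_right])
    have hQeq : ({b} ∆ {u} ∆ {(0 : Site 3)}) ∆ {w} = Q := by rw [hQdef]; ac_rfl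
    rwa [hQeq] at h2
  refine ⟨isingCorr G₁ (box 3 (2 * m + 2)) β 0 .free Q * Real.exp (-(β * D.card)) ^ 2,
    mul_pos hc₀ (pow_pos (Real.exp_pos _) 2), 2 * m + 2, fun L hL => ?_⟩
  have hA : ({(0 : Site 3)} : Finset (Site 3)) ∆ {b} ⊆ box 3 L := symmDiff_subset_of_subset
    (Finset.singleton_subset_iff.2 (zero_mem_box 3 L)) (Finset.singleton_subset_iff.2 (box_mono 3 (by omega) hbbox))
  have key := truncatedPair_lower_bound 3 L hβ hA
    ((even_card_symmDiff_iff _ _).2 (by rw [Finset.card_singleton, Finset.card_singleton]))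
    (box_mono 3 (by omega) hubox) (box_mono 3 (by omega) hwbox) huS hwS (hDin L hL)
  rw [symmDiff_assoc] at key
  rw [spinMonomial_four_eq_spinProduct, spinMonomial_two, spinMonomial_two,
    spinPair_eq_spinProduct_symmDiff]
  exact le_trans (mul_le_mul_of_nonneg_right
    (isingCorr_free_le_of_subset G₁ hβ.le le_rfl hQbox (box_mono 3 hL)) (sq_nonneg _)) key

/-! ### Box limit and the stub -/

/-- **Box limit.** A uniform eventual lower bound `c > 0` for the free-box truncations
`⟨∏σ_x⟩_{Λ_L} - ⟨∏σ_y⟩_{Λ_L}⟨∏σ_z⟩_{Λ_L}` at `β_c` passes to the critical correlators of `ℤ³`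
(`criticalCorr_wellDefined_holds`, the free boundary condition). [folklore] -/
theorem criticalTruncation_pos_of_box {x : Fin 4 → Site 3} {y z : Fin 2 → Site 3} {c : ℝ}
    (hc : 0 < c) {L₀ : ℕ} (h : ∀ L : ℕ, L₀ ≤ L →
      c ≤ isingExpect (zdGraph 3) (box 3 L) (criticalBeta 3) 0 .free (spinMonomial x) -
        isingExpect (zdGraph 3) (box 3 L) (criticalBeta 3) 0 .free (spinMonomial y) *
          isingExpect (zdGraph 3) (box 3 L) (criticalBeta 3) 0 .free (spinMonomial z)) :
    0 < criticalCorr 3 4 x - criticalCorr 3 2 y * criticalCorr 3 2 z := by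
  have hl : ∀ (n : ℕ) (v : Fin n → Site 3), Tendsto (fun L : ℕ =>
      isingExpect (zdGraph 3) (box 3 L) (criticalBeta 3) 0 .free (spinMonomial v)) atTop
      (𝓝 (criticalCorr 3 n v)) :=
    fun n v => criticalCorr_wellDefined_holds (d := 3) le_rfl n v _ (Set.mem_insert _ _)
  exact hc.trans_le (ge_of_tendsto ((hl 4 x).sub ((hl 2 y).mul (hl 2 z))) (eventually_atTop.2 ⟨L₀, h⟩))

/-- **Stub 3 of line `rp-unpinch-single-passage` — strict positivity of the single-pinch
truncation at every scale**: for `m ≥ 1`,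
`0 < ⟨σ₀σ_{e₂}σ_{(2m,m,0)}σ_{(2m,-m,0)}⟩_{β_c} - ⟨σ₀σ_{e₂}⟩_{β_c}⟨σ_{(2m,m,0)}σ_{(2m,-m,0)}⟩_{β_c}`
on `ℤ³` (the uniform box bound `singlePinch_box_lower_bound` at `β = β_c > 0`,
`criticalBeta_pos_holds`, and the box limit `criticalTruncation_pos_of_box`). [folklore] -/
theorem stub_singlePinchPositive :
    ∀ m : ℕ, 1 ≤ m →
      0 < criticalCorr 3 4 ![0, e₂, Pi.single 0 (2 * (m : ℤ)) + Pi.single 1 (m : ℤ), Pi.single 0 (2 * (m : ℤ)) - Pi.single 1 (m : ℤ)] - criticalCorr 3 2 ![0, e₂] * criticalCorr 3 2 ![Pi.single 0 (2 * (m : ℤ)) + Pi.single 1 (m : ℤ), Pi.single 0 (2 * (m : ℤ)) - Pi.single 1 (m : ℤ)] := by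
  intro m hm
  obtain ⟨c, hc, L₀, hL₀⟩ := singlePinch_box_lower_bound (criticalBeta_pos_holds (d := 3) (by norm_num)) hm
  exact criticalTruncation_pos_of_box hc hL₀

end Summit.CriticalPhenomena.Ising3DConformalLimit.EnergyNotSigmaSquaredGapForcesFarMerging

end
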